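import Mathlib
import Summits.ValiantsHypothesis.ValiantsHypothesis.Theorems.FifoMatchingNNDivisionHardLowDimFace
import Literature.Barriers.PneNP.TSPExtensionComplexityFaces
import Literature.Barriers.PneNP.ExtendedFormulationLinearImage

/-!
# The permutahedron passenger `Q^Π_λ` (crux `FifoMatching.NNDivisionHard`, stmt-ValiantsHypothesis-21181; Negative lane, KILL NOTE N22)
val-idea-crit-9 g2 (critic of record, WAVE 6).  First file of the kernel of N22 (`LocatedPencilLaw` = `entryTilted.Law` of
`CliqueRowBlind.lean` rev 6 §4 is false): the DIAGONAL passenger `Q^Π_λ = conv{q_π : π ∈ S_n}`, `q_π = flat (diagonal (−λ · rk π))`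
(`rk π i = (π i : ℕ)`), its extension complexity `≤ n²` (Birkhoff–von Neumann: the doubly stochastic polytope is the
transportation system, `Q^Π_λ` a linear image), the pairing `⟨udRow a + flat W, q_π⟩ = −λ Σ_i (𝟙_a(i) + W_ii)·rk π i`, and the
rearrangement facts used by the factorization: `pmin v = min_π ⟨v, rk π⟩` is attained at every permutation antivarying with `v`
(one exists, by sorting), and for an indicator `v = 𝟙_c` the excess `⟨𝟙_c, rk π⟩ − pmin 𝟙_c` is the inversion count
`inv c π = #{(i ∈ c, j ∉ c) : π j < π i}`.  Theorems and concrete data only; VP ≠ VNP is NOT proved; the crux stays OPEN.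
-/

namespace Summit.ValiantsHypothesis.Theorems.NNDivisionHardNegative.LocatedPencil

open Matrix Finset
open Literature.Barriers.PneNP (HasEFOfSize hasEFOfSize_of_system)
open Literature.Combinatorics.Optimization.FixedSizePsdRank (flat vecOuter flat_dotProduct_vecOuter)
open Summit.ValiantsHypothesis.ValiantsHypothesis.Theorems.FifoMatching.XcDivision
  (udInd udPt udRow udInd_apply ud_data udRow_dotProduct_flat_diagonal flat_dotProduct_flat)

noncomputable section

variable {n : ℕ}

/-! ## §1 Rank weights, `pval`, `pmin`, rearrangement -/

/-- the rank weight `rk π i = (π i : ℕ)` of index `i` under the permutation `π`. -/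
def rk (π : Equiv.Perm (Fin n)) (i : Fin n) : ℝ := ((π i : ℕ) : ℝ)

/-- `⟨v, rk π⟩ = Σ_i v_i · rk π i`. -/
def pval (v : Fin n → ℝ) (π : Equiv.Perm (Fin n)) : ℝ := ∑ i, v i * rk π i

/-- `pmin v = min_π ⟨v, rk π⟩` (a minimum over the finite set of permutations). -/
def pmin (v : Fin n → ℝ) : ℝ := Finset.univ.inf' Finset.univ_nonempty (pval v)

/-- `pmin v ≤ ⟨v, rk π⟩`. -/
theorem pmin_le (v : Fin n → ℝ) (π : Equiv.Perm (Fin n)) : pmin v ≤ pval v π :=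
  Finset.inf'_le _ (Finset.mem_univ π)

/-- the minimum is attained. -/
theorem exists_pval_eq_pmin (v : Fin n → ℝ) : ∃ π : Equiv.Perm (Fin n), pval v π = pmin v := by
  obtain ⟨π, -, h⟩ := Finset.exists_mem_eq_inf' Finset.univ_nonempty (pval v)
  exact ⟨π, h.symm⟩

/-- **rearrangement**: a permutation antivarying with `v` (larger `v_i` ↦ smaller rank) minimises `⟨v, rk ·⟩`. -/
theorem pval_le_of_antivary {v : Fin n → ℝ} {π : Equiv.Perm (Fin n)} (h : Antivary v (rk π))
    (π' : Equiv.Perm (Fin n)) : pval v π ≤ pval v π' := by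
  have key := h.sum_mul_le_sum_mul_comp_perm (σ := π'.trans π.symm)
  simpa [pval, rk, Equiv.trans_apply, Equiv.apply_symm_apply] using key

/-- `pmin v = ⟨v, rk π⟩` for every `π` antivarying with `v`. -/
theorem pmin_eq_of_antivary {v : Fin n → ℝ} {π : Equiv.Perm (Fin n)} (h : Antivary v (rk π)) :
    pmin v = pval v π := by
  refine le_antisymm (pmin_le v π) ?_
  obtain ⟨π', h'⟩ := exists_pval_eq_pmin v
  rw [← h']
  exact pval_le_of_antivary h π'

/-- a permutation antivarying with `v` exists (sort `v` increasingly and reverse the positions). -/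
theorem exists_antivary (v : Fin n → ℝ) : ∃ π : Equiv.Perm (Fin n), Antivary v (rk π) := by
  refine ⟨(Tuple.sort v).symm.trans Fin.revPerm, fun i j hij => ?_⟩
  have h1 : Fin.rev ((Tuple.sort v).symm i) < Fin.rev ((Tuple.sort v).symm j) := by
    simp only [rk, Equiv.trans_apply, Fin.revPerm_apply, Nat.cast_lt] at hij
    exact Fin.lt_def.mpr hij
  have h2 : (Tuple.sort v).symm j < (Tuple.sort v).symm i := Fin.rev_lt_rev.mp h1
  have h3 := Tuple.monotone_sort v (le_of_lt h2)
  simpa [Function.comp, Equiv.apply_symm_apply] using h3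

/-- antivariance transfers along an order-compatible relabelling of the values. -/
theorem antivary_of_imp {v v' g : Fin n → ℝ} (h : Antivary v g) (hm : ∀ i j, v j ≤ v i → v' j ≤ v' i) :
    Antivary v' g := fun _ _ hij => hm _ _ (h hij)

/-- under an antivarying `π`, a strictly larger value gets a strictly smaller rank. -/
theorem rk_lt_of_antivary {v : Fin n → ℝ} {π : Equiv.Perm (Fin n)} (h : Antivary v (rk π)) {i j : Fin n}
    (hij : v j < v i) : rk π i < rk π j := by
  rcases lt_or_ge (rk π i) (rk π j) with hlt | hle
  · exact hlt
  · exfalso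
    rcases lt_or_eq_of_le hle with hlt' | heq
    · exact absurd (h hlt') (not_le.mpr hij)
    · have : π j = π i := Fin.ext (by unfold rk at heq; exact_mod_cast heq)
      have hji : j = i := π.injective this
      rw [hji] at hij
      exact lt_irrefl _ hij

/-! ## §2 Indicators: `⟨𝟙_c, rk π⟩ = |c|(|c|−1)/2 + inv c π`, `pmin 𝟙_c = |c|(|c|−1)/2` -/

/-- the inversion count of `c` under `π`: pairs `(i ∈ c, j ∉ c)` with `π j < π i` (as a real). -/
def inv (c : Finset (Fin n)) (π : Equiv.Perm (Fin n)) : ℝ :=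
  ∑ i ∈ c, ∑ j ∈ cᶜ, if π j < π i then (1 : ℝ) else 0

/-- `inv c π ≥ 0`. -/
theorem inv_nonneg (c : Finset (Fin n)) (π : Equiv.Perm (Fin n)) : 0 ≤ inv c π :=
  Finset.sum_nonneg fun _ _ => Finset.sum_nonneg fun _ _ => by split_ifs <;> norm_num

/-- `rk π i = #{j : π j < π i}`. -/
theorem rk_eq_sum (π : Equiv.Perm (Fin n)) (i : Fin n) :
    rk π i = ∑ j, if π j < π i then (1 : ℝ) else 0 := by
  rw [Equiv.sum_comp π (fun x => if x < π i then (1 : ℝ) else 0), Finset.sum_boole]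
  have : (Finset.univ.filter fun x : Fin n => x < π i) = Finset.Iio (π i) := by
    ext x; simp
  rw [this, Fin.card_Iio, rk]

/-- the number of ordered pairs `i ≠ j` inside `c` with `π j < π i` is `|c|(|c|−1)/2`. -/
theorem sum_sum_lt_self (c : Finset (Fin n)) (π : Equiv.Perm (Fin n)) :
    ∑ i ∈ c, ∑ j ∈ c, (if π j < π i then (1 : ℝ) else 0) = (c.card : ℝ) * (c.card - 1) / 2 := by
  have hsym : ∑ i ∈ c, ∑ j ∈ c, (if π j < π i then (1 : ℝ) else 0)
      = ∑ i ∈ c, ∑ j ∈ c, (if π i < π j then (1 : ℝ) else 0) := Finset.sum_comm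
  have hsum : ∑ i ∈ c, ∑ j ∈ c, ((if π j < π i then (1 : ℝ) else 0) + (if π i < π j then (1 : ℝ) else 0))
      = ∑ i ∈ c, ∑ j ∈ c, (if i = j then (0 : ℝ) else 1) := by
    refine Finset.sum_congr rfl fun i _ => Finset.sum_congr rfl fun j _ => ?_
    by_cases hij : i = j
    · subst hij; simp
    · have hne : π i ≠ π j := fun h => hij (π.injective h)
      rcases lt_or_gt_of_ne hne with h | h
      · rw [if_neg (not_lt.mpr h.le), if_pos h, if_neg hij]; ring
      · rw [if_pos h, if_neg (not_lt.mpr h.le), if_neg hij]; ring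
  have hdiag : ∑ i ∈ c, ∑ j ∈ c, (if i = j then (0 : ℝ) else 1) = (c.card : ℝ) * (c.card - 1) := by
    have : ∀ i ∈ c, ∑ j ∈ c, (if i = j then (0 : ℝ) else 1) = (c.card : ℝ) - 1 := by
      intro i hi
      rw [Finset.sum_ite, Finset.sum_const_zero, zero_add, Finset.sum_const, nsmul_eq_mul, mul_one]
      rw [Finset.filter_ne c i, Finset.card_erase_of_mem hi, Nat.cast_sub (Finset.card_pos.mpr ⟨i, hi⟩)]
      simp
    rw [Finset.sum_congr rfl this, Finset.sum_const, nsmul_eq_mul]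
  have h2 : 2 * ∑ i ∈ c, ∑ j ∈ c, (if π j < π i then (1 : ℝ) else 0) = (c.card : ℝ) * (c.card - 1) := by
    rw [two_mul]
    nth_rewrite 2 [hsym]
    rw [← Finset.sum_add_distrib, ← hdiag, ← hsum]
    exact Finset.sum_congr rfl fun i _ => Finset.sum_add_distrib.symm
  linarith

/-- `⟨𝟙_c, rk π⟩ = |c|(|c|−1)/2 + inv c π`. -/
theorem pval_udInd (c : Finset (Fin n)) (π : Equiv.Perm (Fin n)) :
    pval (udInd c) π = (c.card : ℝ) * (c.card - 1) / 2 + inv c π := by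
  classical
  have h1 : pval (udInd c) π = ∑ i ∈ c, rk π i := by
    unfold pval
    simp only [udInd_apply, ite_mul, one_mul, zero_mul]
    rw [Finset.sum_ite_mem, Finset.univ_inter]
  rw [h1, ← sum_sum_lt_self c π, inv, ← Finset.sum_add_distrib]
  refine Finset.sum_congr rfl fun i _ => ?_
  rw [rk_eq_sum, ← Finset.sum_add_sum_compl c]

/-- under a permutation antivarying with `𝟙_c` there are no inversions. -/
theorem inv_eq_zero_of_antivary {c : Finset (Fin n)} {π : Equiv.Perm (Fin n)} (h : Antivary (udInd c) (rk π)) :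
    inv c π = 0 := by
  refine Finset.sum_eq_zero fun i hi => Finset.sum_eq_zero fun j hj => ?_
  rw [Finset.mem_compl] at hj
  have hlt : udInd c j < udInd c i := by rw [udInd_apply, udInd_apply, if_pos hi, if_neg hj]; norm_num
  have hr := rk_lt_of_antivary h hlt
  have : ¬ π j < π i := by
    intro hc
    have : rk π j < rk π i := by unfold rk; exact_mod_cast hc
    exact absurd hr (not_lt.mpr this.le)
  rw [if_neg this]

/-- `pmin 𝟙_c = |c|(|c|−1)/2`. -/
theorem pmin_udInd (c : Finset (Fin n)) : pmin (udInd c) = (c.card : ℝ) * (c.card - 1) / 2 := by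
  obtain ⟨π, hπ⟩ := exists_antivary (udInd c)
  rw [pmin_eq_of_antivary hπ, pval_udInd, inv_eq_zero_of_antivary hπ, add_zero]

/-- the recourse of an indicator row: `⟨𝟙_c, rk π⟩ − pmin 𝟙_c = inv c π`. -/
theorem pval_sub_pmin_udInd (c : Finset (Fin n)) (π : Equiv.Perm (Fin n)) :
    pval (udInd c) π - pmin (udInd c) = inv c π := by
  rw [pval_udInd, pmin_udInd]; ring

/-! ## §3 The passenger `q_π` and its pairings -/

/-- the vertex `q_π = flat (diagonal (−λ · rk π))` of the permutahedron passenger `Q^Π_λ`. -/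
def qPerm (n : ℕ) (lam : ℝ) (π : Equiv.Perm (Fin n)) : Fin (n * n) → ℝ :=
  flat (Matrix.diagonal fun i => -(lam * rk π i))

/-- `⟨udRow a + flat W, q_π⟩ = −λ · ⟨𝟙_a + diag W, rk π⟩`. -/
theorem rho_dotProduct_qPerm (a : Finset (Fin n)) (W : Matrix (Fin n) (Fin n) ℝ) (lam : ℝ)
    (π : Equiv.Perm (Fin n)) :
    (udRow a + flat W) ⬝ᵥ qPerm n lam π = -(lam * pval (fun i => udInd a i + W i i) π) := by
  classical
  rw [add_dotProduct, qPerm, udRow_dotProduct_flat_diagonal, flat_dotProduct_flat]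
  have h2 : ∀ i, ∑ j, W i j * Matrix.diagonal (fun i => -(lam * rk π i)) i j = W i i * -(lam * rk π i) := by
    intro i
    rw [Finset.sum_eq_single i (fun j _ hji => by rw [Matrix.diagonal_apply_ne _ (Ne.symm hji), mul_zero])
      (fun h => absurd (Finset.mem_univ i) h), Matrix.diagonal_apply_eq]
  simp only [h2, pval]
  have h1 : ∑ i ∈ a, -(lam * rk π i) = ∑ i, udInd a i * -(lam * rk π i) := by
    simp only [udInd_apply, ite_mul, one_mul, zero_mul]
    rw [Finset.sum_ite_mem, Finset.univ_inter]
  rw [h1, ← Finset.sum_add_distrib, Finset.mul_sum, ← Finset.sum_neg_distrib]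
  exact Finset.sum_congr rfl fun i _ => by ring

/-- `⟨udRow a + flat W, udPt b⟩ = 1 − (1 − |a∩b|)² + Σ_{i,j} W_ij b_i b_j`. -/
theorem rho_dotProduct_udPt (a : Finset (Fin n)) (W : Matrix (Fin n) (Fin n) ℝ) (b : Finset (Fin n)) :
    (udRow a + flat W) ⬝ᵥ udPt b
      = (1 - (1 - ((a ∩ b).card : ℝ)) ^ 2) + ∑ i, ∑ j, W i j * (udInd b i * udInd b j) := by
  rw [add_dotProduct, udPt, flat_dotProduct_vecOuter]
  have := (ud_data n).2.2.1 a b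
  rw [udPt] at this
  linarith

/-! ## §4 `xc(Q^Π_λ) ≤ n²` (Birkhoff–von Neumann) -/

/-- the transportation description of the (uncurried) doubly stochastic matrices. -/
def dsSet (n : ℕ) : Set (Fin n × Fin n → ℝ) :=
  {z | (∀ p, 0 ≤ z p) ∧ (∀ i, ∑ j, z (i, j) = 1) ∧ ∀ j, ∑ i, z (i, j) = 1}

/-- constraint matrix of the transportation system (rows: `z_p − y_p = 0`, row sums, column sums). -/
def dsE (n : ℕ) : Matrix ((Fin n × Fin n) ⊕ (Fin n ⊕ Fin n)) (Fin n × Fin n) ℝ := fun r p =>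
  match r with
  | Sum.inl p' => if p' = p then 1 else 0
  | Sum.inr (Sum.inl i) => if p.1 = i then 1 else 0
  | Sum.inr (Sum.inr j) => if p.2 = j then 1 else 0

/-- slack columns of the transportation system (`−y_p` in the rows `z_p − y_p = 0`). -/
def dsF (n : ℕ) : Matrix ((Fin n × Fin n) ⊕ (Fin n ⊕ Fin n)) (Fin n × Fin n) ℝ := fun r p =>
  match r with
  | Sum.inl p' => if p' = p then -1 else 0
  | Sum.inr _ => 0

/-- right-hand side of the transportation system. -/
def dsg (n : ℕ) : (Fin n × Fin n) ⊕ (Fin n ⊕ Fin n) → ℝ := fun r =>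
  match r with
  | Sum.inl _ => 0
  | Sum.inr _ => 1

/-- the transportation system describes `dsSet`. -/
theorem dsSet_eq_system (n : ℕ) :
    dsSet n = {z | ∃ y : Fin n × Fin n → ℝ, (∀ j, 0 ≤ y j) ∧ dsE n *ᵥ z + dsF n *ᵥ y = dsg n} := by
  classical
  have hrow : ∀ (z y : Fin n × Fin n → ℝ) (r),
      (dsE n *ᵥ z + dsF n *ᵥ y) r =
        match r with
        | Sum.inl p => z p - y p
        | Sum.inr (Sum.inl i) => ∑ j, z (i, j)
        | Sum.inr (Sum.inr j) => ∑ i, z (i, j) := by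
    intro z y r
    rcases r with p | i | j
    · simp only [Pi.add_apply, mulVec, dotProduct, dsE, dsF, ite_mul, one_mul, zero_mul, neg_mul,
        Finset.sum_ite_eq, Finset.mem_univ, if_true]
      ring
    · simp only [Pi.add_apply, mulVec, dotProduct, dsE, dsF, ite_mul, one_mul, zero_mul,
        Finset.sum_const_zero, add_zero]
      rw [Fintype.sum_prod_type, Finset.sum_comm]
      simp
    · simp only [Pi.add_apply, mulVec, dotProduct, dsE, dsF, ite_mul, one_mul, zero_mul,
        Finset.sum_const_zero, add_zero]
      rw [Fintype.sum_prod_type]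
      simp
  ext z
  simp only [dsSet, Set.mem_setOf_eq]
  constructor
  · rintro ⟨hz, hr, hc⟩
    refine ⟨z, hz, funext fun r => ?_⟩
    rw [hrow]
    rcases r with p | i | j
    · simp [dsg]
    · simpa [dsg] using hr i
    · simpa [dsg] using hc j
  · rintro ⟨y, hy, hsys⟩
    have h := fun r => (hrow z y r).symm.trans (congrFun hsys r)
    refine ⟨fun p => ?_, fun i => ?_, fun j => ?_⟩
    · have := h (Sum.inl p); simp only [dsg] at this; linarith [hy p]
    · have := h (Sum.inr (Sum.inl i)); simpa [dsg] using this
    · have := h (Sum.inr (Sum.inr j)); simpa [dsg] using this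

/-- `xc(dsSet n) ≤ n²`. -/
theorem hasEFOfSize_dsSet (n : ℕ) : HasEFOfSize (dsSet n) (n * n) := by
  have h := hasEFOfSize_of_system (dsE n) (dsF n) (dsg n)
  rw [← dsSet_eq_system, Fintype.card_prod, Fintype.card_fin] at h
  exact h

/-- `dsSet n` is the uncurried Birkhoff polytope `conv{uncurried permutation matrices}`. -/
theorem dsSet_eq_convexHull (n : ℕ) :
    dsSet n = convexHull ℝ (Set.range fun σ : Equiv.Perm (Fin n) =>
      fun p : Fin n × Fin n => (σ.permMatrix ℝ) p.1 p.2) := by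
  classical
  let φ : Matrix (Fin n) (Fin n) ℝ →ₗ[ℝ] (Fin n × Fin n → ℝ) :=
    (LinearEquiv.curry ℝ ℝ (Fin n) (Fin n)).symm.toLinearMap
  have hφ : ∀ M : Matrix (Fin n) (Fin n) ℝ, φ M = fun p => M p.1 p.2 := fun M => by
    funext p; rfl
  have h1 : dsSet n = φ '' (doublyStochastic ℝ (Fin n) : Set (Matrix (Fin n) (Fin n) ℝ)) := by
    ext z
    simp only [dsSet, Set.mem_setOf_eq, Set.mem_image, SetLike.mem_coe]
    constructor
    · rintro ⟨hz, hr, hc⟩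
      refine ⟨fun i j => z (i, j), ?_, ?_⟩
      · rw [mem_doublyStochastic_iff_sum]; exact ⟨fun i j => hz (i, j), hr, hc⟩
      · rw [hφ]
    · rintro ⟨M, hM, rfl⟩
      rw [mem_doublyStochastic_iff_sum] at hM
      rw [hφ]
      exact ⟨fun p => hM.1 p.1 p.2, hM.2.1, hM.2.2⟩
  rw [h1, doublyStochastic_eq_convexHull_permMatrix, LinearMap.image_convexHull]
  congr 1
  ext z
  simp only [Set.mem_image, Set.mem_setOf_eq, Set.mem_range]
  constructor
  · rintro ⟨M, ⟨σ, rfl⟩, rfl⟩; exact ⟨σ, by rw [hφ]⟩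
  · rintro ⟨σ, rfl⟩; exact ⟨σ.permMatrix ℝ, ⟨σ, rfl⟩, by rw [hφ]⟩

/-- the linear map `z ↦ flat (diagonal (−λ Σ_j z_{ij} · j))` carrying uncurried permutation matrices to `q_π`. -/
def qLin (n : ℕ) (lam : ℝ) : (Fin n × Fin n → ℝ) →ₗ[ℝ] (Fin (n * n) → ℝ) where
  toFun z := flat (Matrix.diagonal fun i => -(lam * ∑ j, z (i, j) * ((j : ℕ) : ℝ)))
  map_add' z z' := by
    funext p
    simp only [flat, Pi.add_apply]
    rcases eq_or_ne (finProdFinEquiv.symm p).1 (finProdFinEquiv.symm p).2 with h | h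
    · rw [h, Matrix.diagonal_apply_eq, Matrix.diagonal_apply_eq, Matrix.diagonal_apply_eq]
      simp only [add_mul, Finset.sum_add_distrib]; ring
    · rw [Matrix.diagonal_apply_ne _ h, Matrix.diagonal_apply_ne _ h, Matrix.diagonal_apply_ne _ h, add_zero]
  map_smul' r z := by
    funext p
    simp only [flat, Pi.smul_apply, smul_eq_mul, RingHom.id_apply]
    rcases eq_or_ne (finProdFinEquiv.symm p).1 (finProdFinEquiv.symm p).2 with h | h
    · rw [h, Matrix.diagonal_apply_eq, Matrix.diagonal_apply_eq, Finset.mul_sum, Finset.mul_sum, mul_neg,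
        Finset.mul_sum]
      exact congrArg Neg.neg (Finset.sum_congr rfl fun j _ => by ring)
    · rw [Matrix.diagonal_apply_ne _ h, Matrix.diagonal_apply_ne _ h, mul_zero]

/-- `qLin` maps the uncurried permutation matrix of `π` to `q_π`. -/
theorem qLin_permMatrix (lam : ℝ) (π : Equiv.Perm (Fin n)) :
    qLin n lam (fun p : Fin n × Fin n => (π.permMatrix ℝ) p.1 p.2) = qPerm n lam π := by
  classical
  have hs : ∀ i, ∑ j, (π.permMatrix ℝ) i j * ((j : ℕ) : ℝ) = rk π i := by
    intro i
    simp only [Equiv.Perm.permMatrix, PEquiv.toMatrix_apply, Equiv.toPEquiv_apply, Option.mem_def,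
      Option.some.injEq, ite_mul, one_mul, zero_mul]
    rw [Finset.sum_ite_eq, if_pos (Finset.mem_univ _)]
    rfl
  simp only [qLin, LinearMap.coe_mk, AddHom.coe_mk, qPerm, hs]

/-- **`xc(Q^Π_λ) ≤ n²`.** -/
theorem hasEFOfSize_qPerm (n : ℕ) (lam : ℝ) :
    HasEFOfSize (convexHull ℝ (Set.range (qPerm n lam))) (n * n) := by
  have h := (hasEFOfSize_dsSet n).image_linearMap (qLin n lam)
  rw [dsSet_eq_convexHull, LinearMap.image_convexHull, ← Set.range_comp] at h
  convert h using 3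
  funext π
  exact (qLin_permMatrix lam π).symm

end

end Summit.ValiantsHypothesis.Theorems.NNDivisionHardNegative.LocatedPencil
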